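import Summits.QuantumFields.BalabanUV.T4Continuum.Support.ShellMeasureLinearizedRealStructure

/-!
# `T4Continuum.ShellMeasureLinearizedRealFormToy` — NON-VACUITY of the (LR)_j real-form junction OF RECORD: the binder
# set of `ShellMeasureLinearizedRealStructure.realForm_chartData_fixed` (= `B12JacobianReal267`'s complex binders +
# `LQ`/`hLQh`/analyticity/splitting) is JOINTLY INHABITED by a NON-degenerate model — the complexified PARABOLA
# `Q̃(B) = B₁ + B₀²` on `ℂ²` with componentwise conjugation — and its real chart is S33 f3's parabola substitution
(cell `pub-balaban`, sub-cell `t4`, spine estimate NE7c (node U5b); NE7c formalisation swarm, crew seat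
`b2b-balaban-t4-ne7c-formalise-leaf-09` gen 8 — idle-seat non-vacuity companion of row S40 (journal `CLAIMS.log`);
imports S40 `ShellMeasureLinearizedRealStructure` (p217266) ONLY; [folklore]; two toy data `abbrev`s (`conj1`,
`conj2` = Mathlib's `starₗᵢ ℂ` on `ℂ` and on `ℂ × ℂ`), 0 `def … : Prop`, 0 sorry, 0 citations)

HONEST FRAMING.  Finite four-torus programme, rung (B)+1 only — NOT infinite volume, NOT a mass gap, NOT the Clay
problem, NOT summit progress.  NE7c (`T4IndicatorShell.ShellWeightBound`) is NOT PRINTED and NOT PROVED; «NE7c ⇐ the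
named binders».  A TOY: it shows that the hypotheses of the (LR)_j real-form junction of record (S36
`ShellMeasureLinearizedRealForm.realForm_chartData` with the real form CONSTRUCTED, S40 `realForm_chartData_fixed`) are
jointly satisfiable with a GENUINELY NONLINEAR average (`C̃ ≠ 0`), nothing about Bałaban's block averages; trigger c3
(binder shapes jointly inhabited).  Nothing of [Balaban 1983–89] is asserted.

THE MODEL.  `𝒴 := ℂ × ℂ`, `𝒳 := ℂ` (sup norm), conjugations `κ_𝒴 := conj × conj`, `κ_𝒳 := conj` (Mathlib `starₗᵢ ℂ`),
so the real forms are `Fix(κ_𝒴) = ℝ² ⊂ ℂ²`, `Fix(κ_𝒳) = ℝ ⊂ ℂ`; `h X := (0, X)` (`LinearMap.inr`), `LQ̃ := pr₂`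
(`ContinuousLinearMap.snd`, so `LQ̃ h = I`), `C̃(B) := B₀²` (quadratic-analytic with `C₂ = 1` on every ball, entire,
conjugation-equivariant), `D̃(B) := B₀²` (it solves `C̃(B − hD̃(B)) = D̃(B)` EXACTLY: `(B − (0, B₀²))₀ = B₀`), `b = 1`,
`ε = 1/10`, `R = 3` (`9C₂bε = 9/10 < 1`, `3ε ≤ R`, `‖D̃(B)‖ ≤ ‖B‖² ≤ 4C₂ε²` on the ball).  The nonlinear average is
`Q̃(B) = LQ̃B + C̃(B) = B₁ + B₀²` — the complexification of S33 f3's parabola (`ShellMeasureLinearizedToy`: fibres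
`y₁ + y₀² = b`, `D̃(B) = B₀²`, Jacobian 1).
* §1 the binder facts of `realForm_chartData_fixed` for the model, one theorem each (`hκX hκY hLQh hHop hC hCa hq hRC`
  `hDball hDfix hhop hCt`; `hC₂`, `hb` are Mathlib's `zero_le_one`; the instances on `ℂ`, `ℂ × ℂ` are found).
* §2 **`toy_realForm_chartData_fixed`**: a splitting `Ψ` EXISTS (leaf-09-g7's
  `ShellMeasureLinearizedConstraint.exists_splitting_of_rightInverse` on the real pair `(L, h)`, right inverse by S36's
  `realForm_rightInverse`) AND the four conclusions of `realForm_chartData_fixed` hold for it — ONE application, every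
  binder discharged by §1.
* §3 the dictionary with S33 f3: on the real window the real chart is `ι(Φ_ℝ y) = ι y − (0, y₀²)` — the parabola
  substitution `(y₀, y₁) ↦ (y₀, y₁ − y₀²)`.
NOTHING in the countdown moves; NE7c NOT PROVED; spine PROVED 0/9.  HONEST DEPENDENCY (cell): continuum YM on T⁴ ⇐
BetaPertH ∧ nine spine estimates (0/9 proved); BetaPertH ⇐ (D1) ∧ (D4) ∧ CAP+tail; G-an2-4 gates asym, D1 and NE2/3/4.
-/

noncomputable section

open Set Metric Filter Topology

namespace Summit.QuantumFields.BalabanUV.T4Continuum.ShellMeasureLinearizedRealFormToy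

open Literature.MathematicalPhysics.QuantumFieldTheory.Balaban1983to89
open B13Contraction113 (QuadAnalytic)
open ShellMeasureLinearizedRealStructure (realSub incl reP incl_apply conj_incl incl_reP_of_fixed reP_incl coe_reP
  realForm_chartData_fixed)
open ShellMeasureLinearizedRealForm (realForm_rightInverse)
open ShellMeasureLinearizedConstraint (exists_splitting_of_rightInverse)

/-! ## §0 The two conjugations of the model (toy data) -/

/-- complex conjugation on `ℂ` as a conjugate-linear isometric equivalence (Mathlib's `starₗᵢ`). [folklore] -/
abbrev conj1 : ℂ ≃ₗᵢ⋆[ℂ] ℂ := starₗᵢ ℂ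

/-- componentwise complex conjugation on `ℂ × ℂ` (Mathlib's `starₗᵢ` for the product star structure). [folklore] -/
abbrev conj2 : (ℂ × ℂ) ≃ₗᵢ⋆[ℂ] (ℂ × ℂ) := starₗᵢ ℂ

/-! ## §1 The binder facts of `realForm_chartData_fixed` for the parabola model -/

/-- `κ_𝒳` is involutive. [folklore] -/
theorem conj1_conj1 : ∀ X : ℂ, conj1 (conj1 X) = X := fun X => by
  rw [starₗᵢ_apply, starₗᵢ_apply, star_star]

/-- `κ_𝒴` is involutive. [folklore] -/
theorem conj2_conj2 : ∀ B : ℂ × ℂ, conj2 (conj2 B) = B := fun B => by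
  rw [starₗᵢ_apply, starₗᵢ_apply, star_star]

/-- `LQ̃ h = I`: `pr₂ (0, X) = X`. [folklore] -/
theorem snd_inr : ∀ X : ℂ, (ContinuousLinearMap.snd ℂ ℂ ℂ) ((LinearMap.inr ℂ ℂ ℂ) X) = X := fun _ => rfl

/-- `‖h X‖ ≤ b‖X‖` with `b = 1` (sup norm: `‖(0, X)‖ = ‖X‖`). [folklore] -/
theorem norm_inr_le : ∀ X : ℂ, ‖(LinearMap.inr ℂ ℂ ℂ) X‖ ≤ 1 * ‖X‖ := fun X => by
  rw [LinearMap.inr_apply, Prod.norm_mk, norm_zero, max_eq_right (norm_nonneg X), one_mul]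

/-- `C̃(B) = B₀²` is QUADRATIC-ANALYTIC with `C₂ = 1` on every ball: `‖B₀²‖ ≤ ‖B‖²`, and entire along complex lines.
[folklore] -/
theorem quadAnalytic_sq (R : ℝ) : QuadAnalytic (fun Y : ℂ × ℂ => Y.1 ^ 2) 1 R where
  quad Y _ := by
    rw [norm_pow, one_mul]
    exact pow_le_pow_left₀ (norm_nonneg _) (norm_fst_le Y) 2
  lineAnalytic P Q := by
    have h : Differentiable ℂ (fun ζ : ℂ => (P + ζ • Q).1 ^ 2) := by
      simp only [Prod.fst_add, Prod.smul_fst, smul_eq_mul]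
      fun_prop
    exact h.differentiableOn

/-- `C̃` is analytic everywhere (a polynomial in the first coordinate). [folklore] -/
theorem analyticOnNhd_sq (s : Set (ℂ × ℂ)) : AnalyticOnNhd ℂ (fun Y : ℂ × ℂ => Y.1 ^ 2) s :=
  fun Y _ => ((ContinuousLinearMap.fst ℂ ℂ ℂ).analyticAt Y).pow 2

/-- the smallness `9C₂bε < 1` of the model: `9·1·1·(1/10) < 1`. [folklore] -/
theorem nine_lt : 9 * (1:ℝ) * 1 * (1 / 10) < 1 := by norm_num

/-- the coupling `3ε ≤ R` of the model: `3/10 ≤ 3`. [folklore] -/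
theorem three_le : 3 * (1 / 10 : ℝ) ≤ 3 := by norm_num

/-- `D̃(B) = B₀²` lies in the ball `4C₂ε²` for `‖B‖ < ε`. [folklore] -/
theorem sq_mem_closedBall : ∀ B : ℂ × ℂ, ‖B‖ < 1 / 10 →
    (fun Y : ℂ × ℂ => Y.1 ^ 2) B ∈ closedBall (0:ℂ) (4 * 1 * (1 / 10) ^ 2) := fun B hB => by
  rw [mem_closedBall, dist_zero_right, norm_pow]
  have h1 : ‖B.1‖ ≤ 1 / 10 := (norm_fst_le B).trans hB.le
  have h0 : 0 ≤ ‖B.1‖ := norm_nonneg _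
  nlinarith

/-- `D̃` SOLVES print's fixed-point equation EXACTLY: `C̃(B − hD̃(B)) = ((B − (0, B₀²))₀)² = B₀² = D̃(B)`. [folklore] -/
theorem sq_fixedPt : ∀ B : ℂ × ℂ, ‖B‖ < 1 / 10 →
    (fun Y : ℂ × ℂ => Y.1 ^ 2) (B - (LinearMap.inr ℂ ℂ ℂ) ((fun Y : ℂ × ℂ => Y.1 ^ 2) B)) =
      (fun Y : ℂ × ℂ => Y.1 ^ 2) B := fun B _ => by
  simp only [LinearMap.inr_apply, Prod.fst_sub, sub_zero]

/-- `h` is conjugation-equivariant: `(0, conj X) = conj (0, X)`. [folklore] -/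
theorem inr_conj : ∀ X : ℂ, (LinearMap.inr ℂ ℂ ℂ) (conj1 X) = conj2 ((LinearMap.inr ℂ ℂ ℂ) X) := fun X => by
  rw [LinearMap.inr_apply, LinearMap.inr_apply, starₗᵢ_apply, starₗᵢ_apply, Prod.star_def, Prod.fst, Prod.snd,
    star_zero]

/-- `C̃` is conjugation-equivariant: `(conj B₀)² = conj (B₀²)`. [folklore] -/
theorem sq_conj : ∀ Y : ℂ × ℂ, ‖Y‖ < 3 →
    (fun Y : ℂ × ℂ => Y.1 ^ 2) (conj2 Y) = conj1 ((fun Y : ℂ × ℂ => Y.1 ^ 2) Y) := fun Y _ => by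
  simp only [starₗᵢ_apply, Prod.fst_star, star_pow]

/-! ## §2 FIRE: the splitting exists and `realForm_chartData_fixed` holds in the model -/

/-- **NON-VACUITY OF THE (LR)_j REAL-FORM JUNCTION OF RECORD — NON-DEGENERATE MODEL.**  For the complexified parabola
(`𝒴 = ℂ²`, `𝒳 = ℂ`, componentwise conjugation, `h X = (0, X)`, `LQ̃ = pr₂`, `C̃(B) = D̃(B) = B₀²`, `C₂ = b = 1`,
`ε = 1/10`, `R = 3`): a splitting `Ψ : ker L × Fix(κ_𝒳) ≃ Fix(κ_𝒴)` with `(Ψ.symm y).2 = L y` EXISTS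
(`ShellMeasureLinearizedConstraint.exists_splitting_of_rightInverse`, right inverse by
`ShellMeasureLinearizedRealForm.realForm_rightInverse`), and for it the FOUR conclusions of
`ShellMeasureLinearizedRealStructure.realForm_chartData_fixed` hold — the real chart `B ↦ B − h (D̃_ℝ B)` on
`Fix(κ_𝒴) = ℝ²` is measurable, injective on the real window `‖ι B‖ < 1/10`, differentiable within it, and linearizes
the real average into `(Ψ.symm B).2` — with EVERY binder discharged by §1 (one application). [folklore] -/
theorem toy_realForm_chartData_fixed :
    ∃ Ψ : (LinearMap.ker ((reP conj1 conj1_conj1 ∘L (ContinuousLinearMap.snd ℂ ℂ ℂ).restrictScalars ℝ ∘L incl conj2) :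
        realSub conj2 →ₗ[ℝ] realSub conj1) × realSub conj1) ≃L[ℝ] realSub conj2,
      (∀ y, (Ψ.symm y).2 =
        (reP conj1 conj1_conj1 ∘L (ContinuousLinearMap.snd ℂ ℂ ℂ).restrictScalars ℝ ∘L incl conj2) y) ∧
      Measurable (fun B : realSub conj2 => B -
        (reP conj2 conj2_conj2 ∘L ((LinearMap.inr ℂ ℂ ℂ).mkContinuous 1 norm_inr_le).restrictScalars ℝ ∘L incl conj1)
          (({y : realSub conj2 | ‖incl conj2 y‖ < 1 / 10}).piecewise
            (fun y => reP conj1 conj1_conj1 ((incl conj2 y).1 ^ 2)) 0 B)) ∧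
      InjOn (fun B : realSub conj2 => B -
        (reP conj2 conj2_conj2 ∘L ((LinearMap.inr ℂ ℂ ℂ).mkContinuous 1 norm_inr_le).restrictScalars ℝ ∘L incl conj1)
          (({y : realSub conj2 | ‖incl conj2 y‖ < 1 / 10}).piecewise
            (fun y => reP conj1 conj1_conj1 ((incl conj2 y).1 ^ 2)) 0 B))
        {y : realSub conj2 | ‖incl conj2 y‖ < 1 / 10} ∧
      (∀ B ∈ {y : realSub conj2 | ‖incl conj2 y‖ < 1 / 10}, HasFDerivWithinAt
        (fun B : realSub conj2 => B -
          (reP conj2 conj2_conj2 ∘L ((LinearMap.inr ℂ ℂ ℂ).mkContinuous 1 norm_inr_le).restrictScalars ℝ ∘L incl conj1)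
            (({y : realSub conj2 | ‖incl conj2 y‖ < 1 / 10}).piecewise
              (fun y => reP conj1 conj1_conj1 ((incl conj2 y).1 ^ 2)) 0 B))
        (ContinuousLinearMap.id ℝ (realSub conj2) -
          (reP conj2 conj2_conj2 ∘L ((LinearMap.inr ℂ ℂ ℂ).mkContinuous 1 norm_inr_le).restrictScalars ℝ ∘L
            incl conj1).comp
            (reP conj1 conj1_conj1 ∘L (fderiv ℂ (fun Y : ℂ × ℂ => Y.1 ^ 2) (incl conj2 B)).restrictScalars ℝ ∘L
              incl conj2))
        {y : realSub conj2 | ‖incl conj2 y‖ < 1 / 10} B) ∧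
      ∀ B ∈ {y : realSub conj2 | ‖incl conj2 y‖ < 1 / 10},
        (reP conj1 conj1_conj1 ∘L (ContinuousLinearMap.snd ℂ ℂ ℂ).restrictScalars ℝ ∘L incl conj2)
            (B - (reP conj2 conj2_conj2 ∘L ((LinearMap.inr ℂ ℂ ℂ).mkContinuous 1 norm_inr_le).restrictScalars ℝ ∘L
              incl conj1)
              (({y : realSub conj2 | ‖incl conj2 y‖ < 1 / 10}).piecewise
                (fun y => reP conj1 conj1_conj1 ((incl conj2 y).1 ^ 2)) 0 B)) +
          (fun y => reP conj1 conj1_conj1 ((incl conj2 y).1 ^ 2))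
            (B - (reP conj2 conj2_conj2 ∘L ((LinearMap.inr ℂ ℂ ℂ).mkContinuous 1 norm_inr_le).restrictScalars ℝ ∘L
              incl conj1)
              (({y : realSub conj2 | ‖incl conj2 y‖ < 1 / 10}).piecewise
                (fun y => reP conj1 conj1_conj1 ((incl conj2 y).1 ^ 2)) 0 B)) = (Ψ.symm B).2 := by
  obtain ⟨Ψ, -, hΨ⟩ := exists_splitting_of_rightInverse
    (reP conj1 conj1_conj1 ∘L (ContinuousLinearMap.snd ℂ ℂ ℂ).restrictScalars ℝ ∘L incl conj2)
    (reP conj2 conj2_conj2 ∘L ((LinearMap.inr ℂ ℂ ℂ).mkContinuous 1 norm_inr_le).restrictScalars ℝ ∘L incl conj1)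
    (realForm_rightInverse (ContinuousLinearMap.snd ℂ ℂ ℂ) snd_inr norm_inr_le inr_conj
      (incl_reP_of_fixed conj2_conj2) (conj_incl conj1) (reP_incl conj1_conj1))
  exact ⟨Ψ, hΨ, realForm_chartData_fixed (Dt := fun Y : ℂ × ℂ => Y.1 ^ 2) conj1_conj1 conj2_conj2
    (ContinuousLinearMap.snd ℂ ℂ ℂ) snd_inr (quadAnalytic_sq 3) (analyticOnNhd_sq _) zero_le_one zero_le_one
    norm_inr_le nine_lt three_le sq_mem_closedBall sq_fixedPt inr_conj sq_conj Ψ hΨ⟩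

/-! ## §3 The dictionary with S33 f3: the real chart is the parabola substitution -/

/-- **THE REAL CHART OF THE MODEL IS S33 f3's PARABOLA SUBSTITUTION**: on the real window, read in `ℂ² ⊃ ℝ²`,
`ι(B − h (D̃_ℝ B)) = ι B − (0, (ι B)₀²)`, i.e. `(y₀, y₁) ↦ (y₀, y₁ − y₀²)` (`ShellMeasureLinearizedToy`'s chart, whose
fibres `y₁ + y₀² = b` are the parabolas of the nonlinear average `Q̃ = pr₂ + C̃`). [folklore] -/
theorem toy_realChart_eq (B : realSub conj2) (hB : ‖incl conj2 B‖ < 1 / 10) :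
    incl conj2 (B - (reP conj2 conj2_conj2 ∘L
        ((LinearMap.inr ℂ ℂ ℂ).mkContinuous 1 norm_inr_le).restrictScalars ℝ ∘L incl conj1)
        (({y : realSub conj2 | ‖incl conj2 y‖ < 1 / 10}).piecewise
          (fun y => reP conj1 conj1_conj1 ((incl conj2 y).1 ^ 2)) 0 B)) =
      incl conj2 B - (0, (incl conj2 B).1 ^ 2) := by
  have hreal : conj1 ((incl conj2 B).1 ^ 2) = (incl conj2 B).1 ^ 2 := by
    have h := conj_incl conj2 B
    rw [starₗᵢ_apply] at h
    rw [starₗᵢ_apply, star_pow, ← Prod.fst_star, h]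
  have hreal2 :
      conj2 ((LinearMap.inr ℂ ℂ ℂ) ((incl conj2 B).1 ^ 2)) = (LinearMap.inr ℂ ℂ ℂ) ((incl conj2 B).1 ^ 2) := by
    rw [← inr_conj, hreal]
  rw [piecewise_eq_of_mem _ _ _ (show B ∈ {y : realSub conj2 | ‖incl conj2 y‖ < 1 / 10} from hB), map_sub]
  simp only [ContinuousLinearMap.coe_comp, Function.comp_apply, ContinuousLinearMap.coe_restrictScalars',
    LinearMap.mkContinuous_apply]
  rw [incl_reP_of_fixed conj1_conj1 _ hreal, incl_reP_of_fixed conj2_conj2 _ hreal2, LinearMap.inr_apply]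

end Summit.QuantumFields.BalabanUV.T4Continuum.ShellMeasureLinearizedRealFormToy

end
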